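import Summits.QuantumFields.YangMills.Theorems.UnitScaleTiltProp7QkLocalGaugeComparison
import Summits.QuantumFields.YangMills.Theorems.UnitScaleTiltProp7LineAvgSmoothNormal
import Literature.MathematicalPhysics.QuantumFieldTheory.Balaban1983to89.B8Ineq129
import Literature.MathematicalPhysics.QuantumFieldTheory.Balaban1983to89.BlockAveragingZd
import Literature.MathematicalPhysics.QuantumFieldTheory.Balaban1983to89.BlockAveragingHaarAC
import HarnessLib

/-!
# Route `UnitScaleTilt`, crux «MinimiserStabilityRegPr» (stmt-QuantumFields-19200, stub EX), γ-row `hGF[Lift]` (LOD line) — (L5c) FILE C, BLOCK-SET EDITION: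
# the `Q_k`∕`L²` rows of ✓`Prop7QkLocalGaugeComparison` with the walk-based gauge hypothesis `hgood` DISCHARGED from the cell's read-controlled block-set letter
# `hax : ∀ b, B(b₋) ∈ S → B(b₊) ∈ S → ‖U₀^σ(b) − 1‖ ≤ δ` (✓`Prop7TubeTransportCloseness`, ✓`Prop7TubeStrSubStairLineIter`) plus `S ⊇` the block-neighbourhood of `supp A`

Cell `ym3-torus` (rung R3 — YM₃ on T³; NOT d = 4, NOT the Clay problem).  Width seat `ym-routeR-w4` g26 (CLAIM 2026-08-30 01:49Z).  THEOREMS ONLY (0 `def`, 0 `sorry`);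
`--supports stmt-QuantumFields-19200 --as helper`; count-neutral.

THE POINT.  The per-cube comparison ✓`Prop7LocalComparisonKnit.localComparison_of_cube` (routeR-w3 g12) displays the (L5c) third as `hKrow` — the conclusion of ✓`normSq_Qk_one_conj_le` —
whose own hypothesis `hgood` asks `U₀^σ` to be `δ`-flat on every bond of the comb walk `x₀(ĉ) → x_r` and of the run `x_r → x_r + te` of every tube term on which `A ≠ 0`.  The (L6)
knitter discharges (L5a)'s `hVplaq` and (L5b)'s `hVbond` from ONE axial gauge on a cube; to feed `hKrow` from the SAME letter this file proves:
* §1 ★ COMB CONTAINMENT (generic torus `P`, level `k`): every step of `walk (fibreSite 0 k y 0) (treeWord r)` (`0 ≤ r_ν < L^k`) has both endpoints in the block `y` — prefixes of a tree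
  word have displacement in the box `[0, r]` (✓`B8Ineq129.disp_prefix_treeWord_mem`, ✓`BlockAveragingZd.disp_eq_netDisp`, ✓`BlockAveragingHaarAC.exists_take_of_mem_walk`), and a site
  `corner(y) + w`, `0 ≤ w ≤ r`, is `fibreSite 0 k y w` (✓`Prop7CombGauge.iterBlockOf_fibreSite`, ✓`fibreSite_shift_of_lt`).  The run half is ✓`iterBlockOf_runSite_fibreSite_or`.
* §2 ★ `hgood` FROM THE BLOCK SET: if `S` contains, for every bond `b` with `A b ≠ 0`, the block `B(b₋)` and its two neighbours `B(b₋) ± e_{μ(b)}`, and `U₀^σ` is `δ`-flat on every fine bond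
  with both endpoint blocks in `S` (`hax`), then `hgood` holds (a live tube term of `ĉ` has `B(b₋) ∈ {ĉ₋, ĉ₊}`, so `ĉ₋, ĉ₊ ∈ S`; comb bonds live in `ĉ₋`, run bonds in `ĉ₋ ∪ ĉ₊`).
* §3 ★★★ THE THREE ROWS OF ✓`Prop7QkLocalGaugeComparison` IN THE BLOCK-SET LETTER: `normSq_Qk_sub_framed_Qk_one_le_of_blockSet`, `abs_normSq_Qk_sub_normSq_Qk_one_conj_le_of_blockSet`,
  `normSq_Qk_one_conj_le_of_blockSet` (= `hKrow` with `cK = 4·(3·10¹⁰L¹⁰ε₀² + 192(ℓδ)²)·cB∕(c₀ℓ^d)`).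
HONEST SCOPE.  Lattice bookkeeping over landed rows; the choice of the cube gauge `σ` and its flatness `hax` ([B6] Lemma 1 on the cube) are the knitter's; (L6), `hT`, `hGF`, the print rows,
`hThm2S`, EX and the crux are NOT proved here.
References: T. Bałaban, CMP **95** (1984) 17–40 [Balaban1984PropagatorsI] ((1.6)–(1.7) p.18, (1.18) p.20); CMP **98** (1985) 17–51 [Balaban1985Averaging] ((14) p.19, p.24, Prop. 4 p.38);
CMP **99** (1985) 75–102 [Balaban1985RegularSpaces] (Lemma 1 (1.25) p.79); CMP **99** (1985) 389–434 [Balaban1985BackgroundPropagators] ((3.13)–(3.16) p.393).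
-/

set_option autoImplicit false

noncomputable section

open scoped BigOperators Matrix.Norms.L2Operator Matrix

namespace Summit.QuantumFields.YangMills.Theorems.Prop7QkLocalGaugeComparisonBlockSet

open Literature.MathematicalPhysics.QuantumFieldTheory.Balaban1983to89
open Literature.MathematicalPhysics.QuantumFieldTheory.Balaban1983to89.T3ContinuumYM3Torus
open Finset T4Continuum BlockAveraging LatticeFieldCalculus B1RG242Torus
open B5Eq118OneStroke (iterBlockOf)
open B7Prop1Explicit (treeWord disp)
open B10Eq27TorusAxialLog (axialT unitsField toUField suIncl)
open B11Eq103H1Complex (BondL2K)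
open B15DeterminingSets (embIter)
open T3LevelShift (bondShift)
open T3PrintedRegularOrbits (sites_eq)
open T3PrintedRegularMinimiser (RegPr)
open T3SectALandauChart (eta)
open Summit.QuantumFields.YangMills.Theorems.Prop7SectET3HilbertLetters (toL2 toL2B)
open Summit.QuantumFields.YangMills.Theorems.Prop7SectET3CurvedPropagators (Qk)
open Summit.QuantumFields.YangMills.Theorems.Prop7SymAvgTwSym (QTwS)
open Summit.QuantumFields.YangMills.Theorems.Prop7TubeTransportCloseness (exists_of_mem_walk_replicate_true iterBlockOf_runSite_fibreSite_or)
open Summit.QuantumFields.YangMills.Theorems.Prop7TubeComparisonRowFlat (iterate_shift_eq_runSite)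
open Summit.QuantumFields.YangMills.Theorems.Prop7CombGauge (iterBlockOf_fibreSite)
open Summit.QuantumFields.YangMills.Theorems.Prop7LineAvgSmoothRightInverse (fibreSite_shift_of_lt)
open Summit.QuantumFields.YangMills.Theorems.Prop7QkLocalGaugeComparison (normSq_Qk_sub_framed_Qk_one_le abs_normSq_Qk_sub_normSq_Qk_one_conj_le normSq_Qk_one_conj_le)

/-! ## §1 Comb containment: the tree contour of a block offset stays in the block -/

section Comb

variable {P : Params} {k : ℕ}

/-- ★ **THE COMB `x₀(y) → x_r` LIVES IN THE BLOCK `y`**: every step of the walk spelled by the tree word of the offset `r` (`0 ≤ r_ν < L^k`) from the block corner `fibreSite 0 k y 0` has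
source AND target in the `k`-block `y`.  (Prefix displacements of a tree word lie in the box `[0, r]`; the corner plus such a displacement is the fibre site of that offset.)
[cite: Balaban1984PropagatorsI, (1.6)-(1.7) p.18; Balaban1985Averaging, (14) p.19, p.24] -/
theorem iterBlockOf_of_mem_walk_treeWord (hk : k ≤ P.m + P.K) (y : Site P k) (r : Fin P.d → Fin (P.L ^ k)) {st : LStep P 0}
    (hst : st ∈ walk (Site.fibreSite 0 k y fun _ => (⟨0, pow_pos P.L_pos k⟩ : Fin (P.L ^ k))) (treeWord fun ν => ((r ν : ℕ) : ℤ))) :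
    iterBlockOf k st.bond.src = y ∧ iterBlockOf k st.bond.tgt = y := by
  have h : P.sitesPerDir 0 = P.L ^ k * P.sitesPerDir k := by
    have := sitesPerDir_zero_eq P k; rwa [lvl_of_le P hk] at this
  set v : B7Prop1Explicit.Site P.d := fun ν => ((r ν : ℕ) : ℤ) with hv
  set x₀ : Site P 0 := Site.fibreSite 0 k y fun _ => (⟨0, pow_pos P.L_pos k⟩ : Fin (P.L ^ k)) with hx₀
  obtain ⟨k₁, k₂, h1, h2⟩ := BlockAveragingHaarAC.exists_take_of_mem_walk x₀ (treeWord v) st hst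
  -- the prefix displacements lie in the box `[0, r]`
  have hbox : ∀ (m : ℕ) (ν : Fin P.d), 0 ≤ netDisp ((treeWord v).take m) ν ∧ netDisp ((treeWord v).take m) ν ≤ ((r ν : ℕ) : ℤ) := by
    intro m ν
    have hsplit : treeWord v = (treeWord v).take m ++ (treeWord v).drop m := (List.take_append_drop m (treeWord v)).symm
    have hb := B8Ineq129.disp_prefix_treeWord_mem v hsplit ν
    rw [BlockAveragingZd.disp_eq_netDisp] at hb
    have hv0 : (0 : ℤ) ≤ v ν := by rw [hv]; positivity
    rw [min_eq_left hv0, max_eq_right hv0] at hb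
    exact hb
  -- the source offset `w`
  have hw1 : ∀ ν, 0 ≤ netDisp ((treeWord v).take k₁) ν := fun ν => (hbox k₁ ν).1
  have hwdir : netDisp ((treeWord v).take k₁) st.bond.dir + 1 ≤ ((r st.bond.dir : ℕ) : ℤ) := by
    have := (hbox k₂ st.bond.dir).2
    rw [h2 st.bond.dir, if_pos rfl] at this
    exact this
  have hwlt : ∀ ν, (netDisp ((treeWord v).take k₁) ν).toNat < P.L ^ k := by
    intro ν
    have hle := (hbox k₁ ν).2
    have : ((netDisp ((treeWord v).take k₁) ν).toNat : ℤ) ≤ ((r ν : ℕ) : ℤ) := by rw [Int.toNat_of_nonneg (hw1 ν)]; exact hle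
    have : (netDisp ((treeWord v).take k₁) ν).toNat ≤ (r ν : ℕ) := by exact_mod_cast this
    exact lt_of_le_of_lt this (r ν).isLt
  set w : Fin P.d → Fin (P.L ^ k) := fun ν => ⟨(netDisp ((treeWord v).take k₁) ν).toNat, hwlt ν⟩ with hw
  have hsrc : st.bond.src = Site.fibreSite 0 k y w := by
    funext ν
    rw [h1 ν, hx₀]
    simp only [Site.fibreSite, hw, add_zero]
    have hcast : ((netDisp ((treeWord v).take k₁) ν : ℤ) : ZMod (P.sitesPerDir 0)) = (((netDisp ((treeWord v).take k₁) ν).toNat : ℕ) : ZMod (P.sitesPerDir 0)) := by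
      rw [← Int.cast_natCast, Int.toNat_of_nonneg (hw1 ν)]
    rw [hcast]
    push_cast
    ring
  have hwd : (w st.bond.dir : ℕ) + 1 < P.L ^ k := by
    have h3 : ((w st.bond.dir : ℕ) : ℤ) + 1 ≤ ((r st.bond.dir : ℕ) : ℤ) := by
      rw [hw]; dsimp only; rw [Int.toNat_of_nonneg (hw1 _)]; exact hwdir
    have h4 : (w st.bond.dir : ℕ) + 1 ≤ (r st.bond.dir : ℕ) := by exact_mod_cast h3
    exact lt_of_le_of_lt h4 (r st.bond.dir).isLt
  refine ⟨?_, ?_⟩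
  · rw [hsrc]; exact iterBlockOf_fibreSite hk h y w
  · show iterBlockOf k (st.bond.src.shift st.bond.dir) = y
    rw [hsrc, fibreSite_shift_of_lt y w st.bond.dir hwd]
    exact iterBlockOf_fibreSite hk h y _

end Comb

/-! ## §2 `hgood` from the block-set letter -/

section Good

variable (F : T3Family) (n K : ℕ)

/-- ★ **THE WALK-BASED GAUGE HYPOTHESIS OF (L5c) FROM THE BLOCK-SET LETTER.**  If `S` contains, for every bond `b` with `A b ≠ 0`, its source block `B(b₋)` together with the two
neighbours `B(b₋) ± e_{μ(b)}`, and `U₀^σ` is `δ`-flat on every fine bond with both endpoint blocks in `S`, then `U₀^σ` is `δ`-flat on the comb and run walks of every tube term on which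
`A ≠ 0` (the `hgood` of ✓`Prop7QkLocalGaugeComparison`∕✓p753355).  [cite: Balaban1984PropagatorsI, (1.18) p.20; Balaban1985Averaging, Prop. 4 (134)-(135) p.38] -/
theorem hgood_of_blockSet (σ : GaugeTransf (F.P K) 0 (Matrix.specialUnitaryGroup (Fin 2) ℂ)) (W : GaugeField (F.P K) 0 (Matrix.specialUnitaryGroup (Fin 2) ℂ)) {δ : ℝ}
    (A : PBond (F.P K) 0 → Matrix (Fin 2) (Fin 2) ℂ)
    (S : Set (Site (F.P K) (K - n)))
    (hax : ∀ b : PBond (F.P K) 0, iterBlockOf (K - n) b.src ∈ S → iterBlockOf (K - n) b.tgt ∈ S →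
      ‖((GaugeField.gaugeAct σ W b : Matrix.specialUnitaryGroup (Fin 2) ℂ) : Matrix (Fin 2) (Fin 2) ℂ) - 1‖ ≤ δ)
    (hS : ∀ b : PBond (F.P K) 0, A b ≠ 0 → ∀ Y : Site (F.P K) (K - n),
      (Y = iterBlockOf (K - n) b.src ∨ Y.shift b.dir = iterBlockOf (K - n) b.src ∨ Y = (iterBlockOf (K - n) b.src).shift b.dir) → Y ∈ S) :
    ∀ (c : PBond (F.P K) (K - n)) (r : Fin (F.P K).d → Fin ((F.P K).L ^ (K - n))) (t : ℕ), t < (F.P K).L ^ (K - n) →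
      A ⟨(fun z : Site (F.P K) 0 => z.shift c.dir)^[t] (Site.fibreSite 0 (K - n) c.src r), c.dir⟩ ≠ 0 →
        (∀ st ∈ walk (Site.fibreSite 0 (K - n) c.src fun _ => (⟨0, pow_pos (F.P K).L_pos (K - n)⟩ : Fin ((F.P K).L ^ (K - n)))) (treeWord fun ν => ((r ν : ℕ) : ℤ)),
            ‖((GaugeField.gaugeAct σ W st.bond : Matrix.specialUnitaryGroup (Fin 2) ℂ) : Matrix (Fin 2) (Fin 2) ℂ) - 1‖ ≤ δ) ∧
        (∀ st ∈ walk (Site.fibreSite 0 (K - n) c.src r) (List.replicate t (c.dir, true)),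
            ‖((GaugeField.gaugeAct σ W st.bond : Matrix.specialUnitaryGroup (Fin 2) ℂ) : Matrix (Fin 2) (Fin 2) ℂ) - 1‖ ≤ δ) := by
  have hk : K - n ≤ (F.P K).m + (F.P K).K := by show K - n ≤ F.m + K; omega
  intro c r t ht hne
  -- the live bond sits in block `ĉ₋` or `ĉ₊`, so both are in `S`
  have hb := iterBlockOf_runSite_fibreSite_or hk c.src r c.dir (s := t) ht.le
  rw [← iterate_shift_eq_runSite] at hb
  have hsrcS : c.src ∈ S := by
    rcases hb with hb | hb
    · exact hS _ hne c.src (Or.inl hb.symm)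
    · exact hS _ hne c.src (Or.inr (Or.inl hb.symm))
  have htgtS : c.src.shift c.dir ∈ S := by
    rcases hb with hb | hb
    · exact hS _ hne (c.src.shift c.dir) (Or.inr (Or.inr (by rw [hb])))
    · exact hS _ hne (c.src.shift c.dir) (Or.inl hb.symm)
  refine ⟨fun st hst => ?_, fun st hst => ?_⟩
  · -- comb bonds: both endpoints in `ĉ₋`
    obtain ⟨h1, h2⟩ := iterBlockOf_of_mem_walk_treeWord hk c.src r hst
    exact hax st.bond (by rw [h1]; exact hsrcS) (by rw [h2]; exact hsrcS)
  · -- run bonds: endpoints in `ĉ₋ ∪ ĉ₊`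
    obtain ⟨s, hs, hst'⟩ := exists_of_mem_walk_replicate_true hst
    rw [hst']
    have hin : ∀ s' : ℕ, s' ≤ (F.P K).L ^ (K - n) → iterBlockOf (K - n) (runSite (Site.fibreSite 0 (K - n) c.src r) c.dir s') ∈ S := by
      intro s' hs'
      rcases iterBlockOf_runSite_fibreSite_or hk c.src r c.dir (s := s') hs' with h1 | h1
      · rw [h1]; exact hsrcS
      · rw [h1]; exact htgtS
    refine hax _ (hin s (by omega)) ?_
    show iterBlockOf (K - n) ((runSite (Site.fibreSite 0 (K - n) c.src r) c.dir s).shift c.dir) ∈ S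
    rw [← runSite_succ]
    exact hin (s + 1) (by omega)

end Good

/-! ## §3 ★★★ The (L5c) rows in the block-set letter -/

section Rows

variable (F : T3Family) (n K : ℕ) (h : n ≤ K) (c₀ cB : ℝ) [Fact (0 < c₀)] [Fact (0 < cB)]

/-- ★★ DIFFERENCE FORM, block-set letter (✓`normSq_Qk_sub_framed_Qk_one_le` + §2). [cite: Balaban1985BackgroundPropagators, (3.13)-(3.16) p.393; Balaban1985RegularSpaces, Lemma 1 (1.25) p.79] -/
theorem normSq_Qk_sub_framed_Qk_one_le_of_blockSet {ε₀ : ℝ} (hε₀ : 0 < ε₀) (hε : 10 ^ 10 * (F.L : ℝ) ^ 6 * ε₀ ≤ 1) (hε12 : 10 ^ 12 * (F.L : ℝ) ^ 3 * ε₀ ≤ 1)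
    (W : GaugeField (F.P K) 0 (Matrix.specialUnitaryGroup (Fin 2) ℂ)) (hreg : RegPr F n K ε₀ W)
    (σ : GaugeTransf (F.P K) 0 (Matrix.specialUnitaryGroup (Fin 2) ℂ)) {δ : ℝ} (hδ : 0 ≤ δ)
    (A : PBond (F.P K) 0 → Matrix (Fin 2) (Fin 2) ℂ)
    (S : Set (Site (F.P K) (K - n)))
    (hax : ∀ b : PBond (F.P K) 0, iterBlockOf (K - n) b.src ∈ S → iterBlockOf (K - n) b.tgt ∈ S →
      ‖((GaugeField.gaugeAct σ W b : Matrix.specialUnitaryGroup (Fin 2) ℂ) : Matrix (Fin 2) (Fin 2) ℂ) - 1‖ ≤ δ)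
    (hS : ∀ b : PBond (F.P K) 0, A b ≠ 0 → ∀ Y : Site (F.P K) (K - n),
      (Y = iterBlockOf (K - n) b.src ∨ Y.shift b.dir = iterBlockOf (K - n) b.src ∨ Y = (iterBlockOf (K - n) b.src).shift b.dir) → Y ∈ S) :
    ‖Qk F n K h c₀ cB W (toL2 F K c₀ A)
        - ((eta F n K : ℝ) : ℂ) • toL2B F n cB (fun c' => B7Eq78Linearization.conjR ((axialT (unitsField (toUField W)) (Site.fibreSite 0 (K - n) (bondShift (sites_eq F n K h) c').src fun _ => (⟨0, pow_pos (F.P K).L_pos (K - n)⟩ : Fin ((F.P K).L ^ (K - n)))) (embIter (K - n) (bondShift (sites_eq F n K h) c').src))⁻¹ * (Unitary.toUnits (suIncl (σ (Site.fibreSite 0 (K - n) (bondShift (sites_eq F n K h) c').src fun _ => (⟨0, pow_pos (F.P K).L_pos (K - n)⟩ : Fin ((F.P K).L ^ (K - n)))))))⁻¹)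
            (QTwS F n K h (1 : GaugeField (F.P K) 0 (Matrix.specialUnitaryGroup (Fin 2) ℂ)) (fun b => ((σ b.src : Matrix.specialUnitaryGroup (Fin 2) ℂ) : Matrix (Fin 2) (Fin 2) ℂ) * A b * star ((σ b.src : Matrix.specialUnitaryGroup (Fin 2) ℂ) : Matrix (Fin 2) (Fin 2) ℂ)) c'))‖ ^ 2
      ≤ 4 * (3 * 10 ^ 10 * (F.L : ℝ) ^ 10 * ε₀ ^ 2 + 192 * ((F.L : ℝ) ^ (K - n) * δ) ^ 2) * (cB / (c₀ * ((F.L : ℝ) ^ (K - n)) ^ (F.P K).d)) * ‖toL2 F K c₀ A‖ ^ 2 :=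
  normSq_Qk_sub_framed_Qk_one_le F n K h c₀ cB hε₀ hε hε12 W hreg σ hδ A (hgood_of_blockSet F n K σ W A S hax hS)

/-- ★★★ THE RELATIVE ROW, block-set letter (✓`abs_normSq_Qk_sub_normSq_Qk_one_conj_le` + §2). [cite: Balaban1985BackgroundPropagators, (3.13)-(3.16) p.393, Thm 3.11 p.416; Balaban1985RegularSpaces, Lemma 1 (1.25) p.79] -/
theorem abs_normSq_Qk_sub_normSq_Qk_one_conj_le_of_blockSet {ε₀ : ℝ} (hε₀ : 0 < ε₀) (hε : 10 ^ 10 * (F.L : ℝ) ^ 6 * ε₀ ≤ 1) (hε12 : 10 ^ 12 * (F.L : ℝ) ^ 3 * ε₀ ≤ 1)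
    (W : GaugeField (F.P K) 0 (Matrix.specialUnitaryGroup (Fin 2) ℂ)) (hreg : RegPr F n K ε₀ W)
    (σ : GaugeTransf (F.P K) 0 (Matrix.specialUnitaryGroup (Fin 2) ℂ)) {δ : ℝ} (hδ : 0 ≤ δ)
    (A : PBond (F.P K) 0 → Matrix (Fin 2) (Fin 2) ℂ)
    (S : Set (Site (F.P K) (K - n)))
    (hax : ∀ b : PBond (F.P K) 0, iterBlockOf (K - n) b.src ∈ S → iterBlockOf (K - n) b.tgt ∈ S →
      ‖((GaugeField.gaugeAct σ W b : Matrix.specialUnitaryGroup (Fin 2) ℂ) : Matrix (Fin 2) (Fin 2) ℂ) - 1‖ ≤ δ)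
    (hS : ∀ b : PBond (F.P K) 0, A b ≠ 0 → ∀ Y : Site (F.P K) (K - n),
      (Y = iterBlockOf (K - n) b.src ∨ Y.shift b.dir = iterBlockOf (K - n) b.src ∨ Y = (iterBlockOf (K - n) b.src).shift b.dir) → Y ∈ S)
    {θ : ℝ} (hθ : 0 < θ) :
    |‖Qk F n K h c₀ cB W (toL2 F K c₀ A)‖ ^ 2 - ‖Qk F n K h c₀ cB (1 : GaugeField (F.P K) 0 (Matrix.specialUnitaryGroup (Fin 2) ℂ)) (toL2 F K c₀ (fun b => ((σ b.src : Matrix.specialUnitaryGroup (Fin 2) ℂ) : Matrix (Fin 2) (Fin 2) ℂ) * A b * star ((σ b.src : Matrix.specialUnitaryGroup (Fin 2) ℂ) : Matrix (Fin 2) (Fin 2) ℂ)))‖ ^ 2|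
      ≤ θ * ‖Qk F n K h c₀ cB W (toL2 F K c₀ A)‖ ^ 2
        + (1 + θ⁻¹) * (4 * (3 * 10 ^ 10 * (F.L : ℝ) ^ 10 * ε₀ ^ 2 + 192 * ((F.L : ℝ) ^ (K - n) * δ) ^ 2) * (cB / (c₀ * ((F.L : ℝ) ^ (K - n)) ^ (F.P K).d))) * ‖toL2 F K c₀ A‖ ^ 2 :=
  abs_normSq_Qk_sub_normSq_Qk_one_conj_le F n K h c₀ cB hε₀ hε hε12 W hreg σ hδ A (hgood_of_blockSet F n K σ W A S hax hS) hθ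

/-- ★★★ **`hKrow` OF ✓`localComparison_of_cube` IN THE BLOCK-SET LETTER**: `‖Q_k(1)(Ad_σA)~‖² ≤ (1+θ)·‖Q_k(U₀)Ã‖² + cK·‖Ã‖²`, `cK = (1+θ⁻¹)·4·(3·10¹⁰L¹⁰ε₀² + 192(ℓδ)²)·cB∕(c₀ℓ^d)`, for
`U₀^σ` `δ`-flat on the fine bonds with both endpoint blocks in a set `S ⊇` the block-neighbourhood of `supp A` (✓`normSq_Qk_one_conj_le` + §2).
[cite: Balaban1985BackgroundPropagators, (3.13)-(3.16) p.393, Thm 3.11 p.416; Balaban1985RegularSpaces, Lemma 1 (1.25) p.79] -/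
theorem normSq_Qk_one_conj_le_of_blockSet {ε₀ : ℝ} (hε₀ : 0 < ε₀) (hε : 10 ^ 10 * (F.L : ℝ) ^ 6 * ε₀ ≤ 1) (hε12 : 10 ^ 12 * (F.L : ℝ) ^ 3 * ε₀ ≤ 1)
    (W : GaugeField (F.P K) 0 (Matrix.specialUnitaryGroup (Fin 2) ℂ)) (hreg : RegPr F n K ε₀ W)
    (σ : GaugeTransf (F.P K) 0 (Matrix.specialUnitaryGroup (Fin 2) ℂ)) {δ : ℝ} (hδ : 0 ≤ δ)
    (A : PBond (F.P K) 0 → Matrix (Fin 2) (Fin 2) ℂ)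
    (S : Set (Site (F.P K) (K - n)))
    (hax : ∀ b : PBond (F.P K) 0, iterBlockOf (K - n) b.src ∈ S → iterBlockOf (K - n) b.tgt ∈ S →
      ‖((GaugeField.gaugeAct σ W b : Matrix.specialUnitaryGroup (Fin 2) ℂ) : Matrix (Fin 2) (Fin 2) ℂ) - 1‖ ≤ δ)
    (hS : ∀ b : PBond (F.P K) 0, A b ≠ 0 → ∀ Y : Site (F.P K) (K - n),
      (Y = iterBlockOf (K - n) b.src ∨ Y.shift b.dir = iterBlockOf (K - n) b.src ∨ Y = (iterBlockOf (K - n) b.src).shift b.dir) → Y ∈ S)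
    {θ : ℝ} (hθ : 0 < θ) :
    ‖Qk F n K h c₀ cB (1 : GaugeField (F.P K) 0 (Matrix.specialUnitaryGroup (Fin 2) ℂ)) (toL2 F K c₀ (fun b => ((σ b.src : Matrix.specialUnitaryGroup (Fin 2) ℂ) : Matrix (Fin 2) (Fin 2) ℂ) * A b * star ((σ b.src : Matrix.specialUnitaryGroup (Fin 2) ℂ) : Matrix (Fin 2) (Fin 2) ℂ)))‖ ^ 2
      ≤ (1 + θ) * ‖Qk F n K h c₀ cB W (toL2 F K c₀ A)‖ ^ 2
        + (1 + θ⁻¹) * (4 * (3 * 10 ^ 10 * (F.L : ℝ) ^ 10 * ε₀ ^ 2 + 192 * ((F.L : ℝ) ^ (K - n) * δ) ^ 2) * (cB / (c₀ * ((F.L : ℝ) ^ (K - n)) ^ (F.P K).d))) * ‖toL2 F K c₀ A‖ ^ 2 :=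
  normSq_Qk_one_conj_le F n K h c₀ cB hε₀ hε hε12 W hreg σ hδ A (hgood_of_blockSet F n K σ W A S hax hS) hθ

end Rows

end Summit.QuantumFields.YangMills.Theorems.Prop7QkLocalGaugeComparisonBlockSet

end
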